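import Summits.QuantumFields.YangMills.Theorems.F4SubCurvatureDoorSubCurvatureClauseMoebiusRowOfDebts
import Summits.QuantumFields.YangMills.Theorems.F4SubCurvatureDoorSubCurvatureClauseLatticeUVFloor
import HarnessLib

/-!
# `MoebiusRow` debt certificate — the UV package SHRINKS to `CompositeAFDebtsUV := ∃ (u → 0⁺) 𝒢 η₁, U1 ∧ U2`

Helper file (`--supports stmt-QuantumFields-23763 --as helper`; free-hands seat `ym-line-frs-p2` g21, at the request of ideator ym-idea-3 g26
02:4xZ 2026-08-30, whose HOME files `g26/u0-lattice-uv-floor.lean` §4 and `g26/chain-24275.lean` rev 3 carry the same three declarations).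
0 sorry, standard axioms.  No item is closed; no summit, no crux and no mass gap is proved by this file.

The tree reduction ✓`MoebiusRowDebts.moebiusRow_of_debts : CompositeAFDebts → MoebiusRow` (p756030) has three debts
`CompositeAFDebts = ∀ G r, U0 ∧ ∃ (u → 0⁺) 𝒢 η₁, U1 ∧ U2`; its S–M conjunct U0 = `LatticeUVFloor r` is PROVED on the tree for every compact `G` and every
`r` (✓`…F4SubCurvatureDoorSubCurvatureClauseLatticeUVFloor.latticeUVFloor_holds`, p757310).  This file names what is left:

* `CompositeAFDebtsUV` — `CompositeAFDebts` with the U0 conjunct removed (the `∃`-clause is byte-identical with the tree's);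
* `compositeAFDebts_of_UV : CompositeAFDebtsUV → CompositeAFDebts` (U0 supplied by `latticeUVFloor_holds`);
* ★ `moebiusRow_of_debtsUV : CompositeAFDebtsUV → MoebiusRow` — the registered stub `stub_moebiusRow` of
  `Cruxes/SubCurvatureClause/Lines/rp_moebius_ladder.lean` (⟨stmt-QuantumFields-23763⟩, line `rp-moebius-ladder`) and the UV stub of the
  ⟨stmt-QuantumFields-24275⟩ export line now rest BY A TREE NAME on exactly the two XL letters U1 `ContinuumDictionary` (lattice → finite-volume
  continuum dictionary, Bałaban UV-stability class with a composite insertion) and U2 `ProfileAFRow` (one asymptotic-freedom block step of the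
  continuum profile).

HONEST LABEL: bookkeeping only; U1, U2, `MoebiusRow`, `CrossoverDecay`, ⟨23763⟩, ⟨24275⟩ OPEN; the Yang–Mills mass gap is NOT proved; no summit
is proved by a line.
-/

set_option autoImplicit false

noncomputable section

open MeasureTheory Filter Topology
open Literature.MathematicalPhysics.QuantumFieldTheory Literature.MathematicalPhysics.QuantumLattice

namespace Summit.QuantumFields.YangMills.Cruxes.SubCurvatureClause.MoebiusRowDebts

/-- **The UV package proper** — `CompositeAFDebts` with its PROVED `U0` conjunct (✓`latticeUVFloor_holds`) removed: for every compact simple `G`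
and every lattice representation `r`, a unit `u → 0⁺`, a two-variable finite-volume continuum profile `𝒢` and a window `η₁` with the continuum
dictionary U1 `ContinuumDictionary r u 𝒢 η₁` and the profile asymptotic-freedom row U2 `ProfileAFRow 𝒢`.  An OPEN package (XL), not a
Literature fact. -/
def CompositeAFDebtsUV : Prop :=
  ∀ (G : Type) [Group G] [TopologicalSpace G] [IsTopologicalGroup G] [CompactSpace G],
    IsCompactSimpleLieGroup G →
    letI : MeasurableSpace G := borel G
    haveI : BorelSpace G := ⟨rfl⟩
    ∀ r : LatticeRep G,
      ∃ (u : ℝ → ℝ) (𝒢 : ℝ → ℝ → ℝ) (η₁ : ℝ), (∀ β, 0 < u β) ∧ Tendsto u atTop (nhds 0) ∧ 0 < η₁ ∧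
        ContinuumDictionary r u 𝒢 η₁ ∧ ProfileAFRow 𝒢

/-- `CompositeAFDebtsUV → CompositeAFDebts`: the `U0` conjunct is the tree theorem `latticeUVFloor_holds` (every compact `G`, every `r`). -/
theorem compositeAFDebts_of_UV (h : CompositeAFDebtsUV) : CompositeAFDebts := by
  intro G _ _ _ _ hG
  letI : MeasurableSpace G := borel G
  haveI : BorelSpace G := ⟨rfl⟩
  intro r
  exact ⟨Summit.QuantumFields.YangMills.Theorems.F4SubCurvatureDoorSubCurvatureClauseLatticeUVFloor.latticeUVFloor_holds r,
    h G hG r⟩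

/-- ★ **`CompositeAFDebtsUV → MoebiusRow`** — the registered stub `stub_moebiusRow` (⟨stmt-QuantumFields-23763⟩ line `rp-moebius-ladder`; also the
UV stub of the ⟨stmt-QuantumFields-24275⟩ export line) rests on `U1 ∧ U2` only: tree `moebiusRow_of_debts ∘ compositeAFDebts_of_UV`. -/
theorem moebiusRow_of_debtsUV (h : CompositeAFDebtsUV) : MoebiusRow :=
  moebiusRow_of_debts (compositeAFDebts_of_UV h)

/-- The conversely trivial direction: the full package implies the UV package (drop U0). [bookkeeping] -/
theorem compositeAFDebtsUV_of_debts (h : CompositeAFDebts) : CompositeAFDebtsUV := by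
  intro G _ _ _ _ hG
  letI : MeasurableSpace G := borel G
  haveI : BorelSpace G := ⟨rfl⟩
  intro r
  exact (h G hG r).2

/-- `CompositeAFDebtsUV ↔ CompositeAFDebts` (U0 is a theorem). [bookkeeping] -/
theorem compositeAFDebtsUV_iff : CompositeAFDebtsUV ↔ CompositeAFDebts :=
  ⟨compositeAFDebts_of_UV, compositeAFDebtsUV_of_debts⟩

end Summit.QuantumFields.YangMills.Cruxes.SubCurvatureClause.MoebiusRowDebts

end
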